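import Summits.QuantumFields.YangMills.Theorems.ColdStartUniversalityLatticeLangevinItoFourthMoment
import Literature.Probability.Process.ItoIntegralCovariation
import Mathlib.Algebra.Order.Chebyshev
import HarnessLib

/-!
# Route `ColdStartUniversality`, rung `stub_fixedCutoffMixing` of K_A1 (stmt-QuantumFields-24809):
# increment moments of an Itô process driven by a Brownian vector (joint filtration)

Helper file (seat `ym-line-csu-p1`, g6) for the `WilsonMeasureLangevinInvariant` wall of the rung
(step 2, Dynkin / Itô formula IN EXPECTATION for the SZZ system by Taylor expansion along
partitions).  One real component of an Itô process driven by the `d` coordinates of a Brownian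
vector `W` w.r.t. the JOINT raw natural filtration,

  `x_t = x_0 + ∫₀ᵗ β_r dr + ∑_k J_k(t)`,  `J_k = ∫ σ_k dW^k`,  `|β| ≤ M`, `|σ_k| ≤ M`

(the shape of every matrix entry of a solution of the lattice Langevin SDE, `LinkSDE.IsSolution`),
has increments `Δ = x_v - x_u = A + N`, `A = ∫_{(u,v]} β dr` (`|A| ≤ M (v-u)`), `N = ∑_k ΔJ_k`, with

* `integral_incr_sq_le` — `E[Δ²] ≤ 2 M² (v-u)² + 2 d² M² (v-u)`;
* `integral_incr_pow_four_le` — `E[Δ⁴] ≤ 8 M⁴ (v-u)⁴ + 72 d⁴ M⁴ (v-u)²`;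
* `memLp_four_incr` — `Δ ∈ L⁴`,

from the isometry bound `IsItoIntegral.integral_sub_sq_le` and the fourth-moment bound
`integral_itoIntegral_coord_sub_pow_four_le`.  These are the moment inputs (`E|Δ| = O(δ^{1/2})`,
`E|Δ|³ = O(δ^{3/2})`) of the Taylor route.  No definition, no sorry, standard axioms.  RECORD-rung
plumbing (R3); the Yang–Mills mass gap is NOT proved.
-/

set_option autoImplicit false

noncomputable section

namespace Summit.QuantumFields.YangMills.Theorems.ColdStartUniversality

open MeasureTheory ProbabilityTheory Filter Finset
open scoped NNReal ENNReal Topology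
open Literature.Probability.Process

/-- `(∑ᵢ zᵢ)⁴ ≤ (#s)³ ∑ᵢ zᵢ⁴` (Cauchy–Schwarz twice). [folklore] -/
theorem pow_four_sum_le {ι : Type*} (s : Finset ι) (z : ι → ℝ) :
    (∑ i ∈ s, z i) ^ 4 ≤ (#s : ℝ) ^ 3 * ∑ i ∈ s, z i ^ 4 := by
  have h1 : (∑ i ∈ s, z i) ^ 2 ≤ #s * ∑ i ∈ s, z i ^ 2 := sq_sum_le_card_mul_sum_sq
  have h2 : (∑ i ∈ s, z i ^ 2) ^ 2 ≤ #s * ∑ i ∈ s, (z i ^ 2) ^ 2 := sq_sum_le_card_mul_sum_sq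
  have h0 : 0 ≤ (∑ i ∈ s, z i) ^ 2 := sq_nonneg _
  calc (∑ i ∈ s, z i) ^ 4 = ((∑ i ∈ s, z i) ^ 2) ^ 2 := by ring
    _ ≤ (#s * ∑ i ∈ s, z i ^ 2) ^ 2 := pow_le_pow_left₀ h0 h1 2
    _ = (#s : ℝ) ^ 2 * (∑ i ∈ s, z i ^ 2) ^ 2 := by ring
    _ ≤ (#s : ℝ) ^ 2 * (#s * ∑ i ∈ s, (z i ^ 2) ^ 2) := by gcongr
    _ = (#s : ℝ) ^ 3 * ∑ i ∈ s, z i ^ 4 := by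
      have h4 : ∑ i ∈ s, (z i ^ 2) ^ 2 = ∑ i ∈ s, z i ^ 4 := sum_congr rfl fun i _ ↦ by ring
      rw [h4]; ring

section Vec

variable {Ω : Type*} {mΩ : MeasurableSpace Ω} {P : Measure Ω} {d : ℕ}
  {W : ℝ≥0 → Ω → (Fin d → ℝ)} {x : ℝ≥0 → Ω → ℝ} {β : ℝ≥0 → Ω → ℝ} {σ J : Fin d → ℝ≥0 → Ω → ℝ}
  {M : ℝ} {u v : ℝ≥0}

/-- The drift part of an increment is bounded: `|∫_{(u,v]} β dr| ≤ M (v - u)`. [folklore] -/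
theorem abs_setIntegral_Ioc_le (hM : ∀ r ω, |β r ω| ≤ M) (huv : u ≤ v) (ω : Ω) :
    |∫ r in Set.Ioc (u : ℝ) v, β r.toNNReal ω| ≤ M * ((v : ℝ) - u) := by
  have h := norm_setIntegral_le_of_norm_le_const (μ := volume) (s := Set.Ioc (u : ℝ) v)
    (f := fun r : ℝ ↦ β r.toNNReal ω) (C := M) (by rw [Real.volume_Ioc]; exact ENNReal.ofReal_lt_top)
    (fun r _ ↦ by rw [Real.norm_eq_abs]; exact hM _ ω)
  rw [Real.volume_real_Ioc_of_le (NNReal.coe_le_coe.2 huv), Real.norm_eq_abs] at h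
  linarith

/-- The drift part of an increment is measurable in `ω`. [folklore] -/
theorem aestronglyMeasurable_setIntegral_Ioc (hβm : Measurable fun p : Ω × ℝ ↦ β p.2.toNNReal p.1) :
    AEStronglyMeasurable (fun ω ↦ ∫ r in Set.Ioc (u : ℝ) v, β r.toNNReal ω) P :=
  (hβm.stronglyMeasurable.integral_prod_right' (ν := volume.restrict (Set.Ioc (u : ℝ) v))).aestronglyMeasurable

/-- **Increment decomposition**: a.s., `x_v - x_u = ∫_{(u,v]} β dr + ∑_k (J_k(v) - J_k(u))`. [folklore] -/
theorem incr_eq_ae (hβm : Measurable fun p : Ω × ℝ ↦ β p.2.toNNReal p.1) (hM : ∀ r ω, |β r ω| ≤ M)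
    (hx : ∀ᵐ ω ∂P, ∀ t, x t ω = x 0 ω + (∫ r in (0 : ℝ)..t, β r.toNNReal ω) + ∑ k, J k t ω)
    (huv : u ≤ v) :
    ∀ᵐ ω ∂P, x v ω - x u ω =
      (∫ r in Set.Ioc (u : ℝ) v, β r.toNNReal ω) + ∑ k, (J k v ω - J k u ω) := by
  filter_upwards [hx] with ω hω
  have hii : ∀ a b : ℝ, IntervalIntegrable (fun r : ℝ ↦ β r.toNNReal ω) volume a b :=
    intervalIntegrable_of_bdd (hβm.comp measurable_prodMk_left) (fun r ↦ hM _ ω)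
  rw [hω v, hω u, sum_sub_distrib, ← intervalIntegral.integral_of_le (NNReal.coe_le_coe.2 huv),
    ← intervalIntegral.integral_interval_sub_left (hii 0 v) (hii 0 u)]
  ring

variable [IsProbabilityMeasure P]

/-- **Moments of the increments of an Itô process with bounded coefficients (joint filtration).**
For `x_t = x_0 + ∫₀ᵗ β + ∑_k ∫₀ᵗ σ_k dW^k` with `|β|, |σ_k| ≤ M` and `u ≤ v`: the increment
`x_v - x_u` is in `L⁴`, `E[(x_v - x_u)²] ≤ 2 M² (v-u)² + 2 d² M² (v-u)` and
`E[(x_v - x_u)⁴] ≤ 8 M⁴ (v-u)⁴ + 72 d⁴ M⁴ (v-u)²`. [folklore] -/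
theorem incr_moments (hW : IsBrownianVec W P)
    (hβ : IsStronglyProgressive hW.natFiltration β) (hσ : ∀ k, IsStronglyProgressive hW.natFiltration (σ k))
    (hβM : ∀ r ω, |β r ω| ≤ M) (hσM : ∀ k r ω, |σ k r ω| ≤ M)
    (hJ : ∀ k, IsItoIntegral (σ k) (fun r ω => W r ω k) (J k) hW.natFiltration P)
    (hx : ∀ᵐ ω ∂P, ∀ t, x t ω = x 0 ω + (∫ r in (0 : ℝ)..t, β r.toNNReal ω) + ∑ k, J k t ω)
    (huv : u ≤ v) :
    MemLp (fun ω ↦ x v ω - x u ω) 4 P ∧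
    ∫ ω, (x v ω - x u ω) ^ 2 ∂P ≤ 2 * M ^ 2 * ((v : ℝ) - u) ^ 2 + 2 * (d : ℝ) ^ 2 * M ^ 2 * ((v : ℝ) - u) ∧
    ∫ ω, (x v ω - x u ω) ^ 4 ∂P ≤
      8 * M ^ 4 * ((v : ℝ) - u) ^ 4 + 72 * (d : ℝ) ^ 4 * M ^ 4 * ((v : ℝ) - u) ^ 2 := by
  have hβm := measurable_toNNReal_of_isStronglyProgressive hβ
  set δ : ℝ := (v : ℝ) - u with hδ
  have hδ0 : 0 ≤ δ := sub_nonneg.2 (NNReal.coe_le_coe.2 huv)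
  -- the pieces
  set A : Ω → ℝ := fun ω ↦ ∫ r in Set.Ioc (u : ℝ) v, β r.toNNReal ω with hA
  set N : Fin d → Ω → ℝ := fun k ω ↦ J k v ω - J k u ω with hN
  have hAb : ∀ ω, |A ω| ≤ M * δ := fun ω ↦ abs_setIntegral_Ioc_le hβM huv ω
  have hAm : AEStronglyMeasurable A P := aestronglyMeasurable_setIntegral_Ioc hβm
  have hMδ : 0 ≤ M * δ := (abs_nonneg _).trans (hAb (Classical.choice (by
    by_contra hne; rw [not_nonempty_iff] at hne
    exact absurd (IsProbabilityMeasure.measure_univ (μ := P))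
      (by rw [Set.univ_eq_empty_iff.2 hne, measure_empty]; exact zero_ne_one))))
  -- coordinate martingale facts
  have hB := fun k ↦ martingale_coord hW k
  have hBsq := fun k ↦ martingale_coord_sq_sub hW k
  have hB2 := fun k (r : ℝ≥0) ↦ memLp_two_coord hW r k
  have hBc := fun k ↦ continuous_coord hW k
  have hσfin : ∀ k (r : ℝ≥0), sqErr (σ k) 0 P r ≠ ∞ := by
    intro k r
    have hle : sqErr (σ k) 0 P r ≤ ∫⁻ _, (∫⁻ _ in Set.Icc (0 : ℝ) r, ENNReal.ofReal (M ^ 2)) ∂P := by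
      unfold sqErr
      refine lintegral_mono fun ω ↦ lintegral_mono fun x ↦ ENNReal.ofReal_le_ofReal ?_
      rw [Pi.zero_apply, Pi.zero_apply, sub_zero, ← sq_abs]
      exact pow_le_pow_left₀ (abs_nonneg _) (hσM k _ ω) 2
    have hfin : ∫⁻ _, (∫⁻ _ in Set.Icc (0 : ℝ) r, ENNReal.ofReal (M ^ 2)) ∂P ≠ ∞ := by
      rw [lintegral_const, lintegral_const, Measure.restrict_apply_univ, Real.volume_Icc]
      exact ENNReal.mul_ne_top (ENNReal.mul_ne_top ENNReal.ofReal_ne_top ENNReal.ofReal_ne_top)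
        (measure_ne_top _ _)
    exact ne_top_of_le_ne_top hfin hle
  have hJm : ∀ k r, AEStronglyMeasurable (J k r) P := fun k r ↦
    IsItoIntegral.aestronglyMeasurable (hB k) (hBsq k) (hB2 k) (hBc k) (hσ k) (hσfin k) (hJ k) r
  -- moments of the martingale increments
  have hN4 : ∀ k, MemLp (N k) 4 P ∧ ∫ ω, N k ω ^ 4 ∂P ≤ 9 * M ^ 4 * δ ^ 2 := fun k ↦
    integral_itoIntegral_coord_sub_pow_four_le hW k (hσ k) (hσM k) (hJ k) (hJm k) huv
  have hN2 : ∀ k, ∫ ω, N k ω ^ 2 ∂P ≤ M ^ 2 * δ := fun k ↦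
    IsItoIntegral.integral_sub_sq_le (hB k) (hBsq k) (hB2 k) (hBc k) (hσ k) (hσM k) (hJ k) huv
  -- `A ∈ L⁴`, `∑ N ∈ L⁴`
  have hA4 : MemLp A 4 P :=
    (memLp_const (M * δ)).of_le_mul (c := 1) hAm (ae_of_all _ fun ω ↦ by
      rw [Real.norm_eq_abs, Real.norm_eq_abs, one_mul, abs_of_nonneg hMδ]; exact hAb ω)
  have hSN4 : MemLp (fun ω ↦ ∑ k, N k ω) 4 P := memLp_finsetSum _ fun k _ ↦ (hN4 k).1
  have hAN4 : MemLp (fun ω ↦ A ω + ∑ k, N k ω) 4 P := hA4.add hSN4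
  -- the increment equals `A + ∑ N` a.s.
  have hae : (fun ω ↦ x v ω - x u ω) =ᵐ[P] fun ω ↦ A ω + ∑ k, N k ω :=
    incr_eq_ae hβm hβM hx huv
  have hΔ4 : MemLp (fun ω ↦ x v ω - x u ω) 4 P := hAN4.ae_eq hae.symm
  refine ⟨hΔ4, ?_, ?_⟩
  · -- second moment
    rw [integral_congr_ae (hae.mono fun ω hω ↦ by simp only [hω] : ∀ᵐ ω ∂P,
      (x v ω - x u ω) ^ 2 = (A ω + ∑ k, N k ω) ^ 2)]
    have iA2 : Integrable (fun ω ↦ A ω ^ 2) P := (hA4.mono_exponent (by norm_num)).integrable_sq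
    have iN2 : ∀ k, Integrable (fun ω ↦ N k ω ^ 2) P := fun k ↦
      ((hN4 k).1.mono_exponent (by norm_num)).integrable_sq
    have iSN2 : Integrable (fun ω ↦ (∑ k, N k ω) ^ 2) P := (hSN4.mono_exponent (by norm_num)).integrable_sq
    have hle : ∀ ω, (A ω + ∑ k, N k ω) ^ 2 ≤ 2 * A ω ^ 2 + 2 * ((d : ℝ) * ∑ k, N k ω ^ 2) := by
      intro ω
      have h1 : (A ω + ∑ k, N k ω) ^ 2 ≤ 2 * A ω ^ 2 + 2 * (∑ k, N k ω) ^ 2 := by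
        nlinarith [sq_nonneg (A ω - ∑ k, N k ω)]
      have h2 : (∑ k, N k ω) ^ 2 ≤ (d : ℝ) * ∑ k, N k ω ^ 2 := by
        have := sq_sum_le_card_mul_sum_sq (s := (univ : Finset (Fin d))) (f := fun k ↦ N k ω)
        simpa using this
      linarith
    have iR : Integrable (fun ω ↦ 2 * A ω ^ 2 + 2 * ((d : ℝ) * ∑ k, N k ω ^ 2)) P :=
      (iA2.const_mul 2).add (((integrable_finsetSum _ fun k _ ↦ iN2 k).const_mul _).const_mul 2)
    refine (integral_mono_of_nonneg (ae_of_all _ fun ω ↦ sq_nonneg _) iR (ae_of_all _ hle)).trans ?_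
    rw [integral_add (iA2.const_mul 2) (((integrable_finsetSum _ fun k _ ↦ iN2 k).const_mul _).const_mul 2),
      integral_const_mul, integral_const_mul, integral_const_mul, integral_finsetSum _ fun k _ ↦ iN2 k]
    have bA : ∫ ω, A ω ^ 2 ∂P ≤ (M * δ) ^ 2 := by
      have h := integral_mono iA2 (integrable_const ((M * δ) ^ 2)) fun ω ↦ (show A ω ^ 2 ≤ (M * δ) ^ 2 by
        rw [← sq_abs]; exact pow_le_pow_left₀ (abs_nonneg _) (hAb ω) 2)
      simpa using h
    have bN : ∑ k, ∫ ω, N k ω ^ 2 ∂P ≤ (d : ℝ) * (M ^ 2 * δ) := by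
      have h := sum_le_sum fun k (_ : k ∈ (univ : Finset (Fin d))) ↦ hN2 k
      simpa using h
    have hd : (0 : ℝ) ≤ d := Nat.cast_nonneg d
    nlinarith [bA, bN, hd]
  · -- fourth moment
    rw [integral_congr_ae (hae.mono fun ω hω ↦ by simp only [hω] : ∀ᵐ ω ∂P,
      (x v ω - x u ω) ^ 4 = (A ω + ∑ k, N k ω) ^ 4)]
    have iA4 : Integrable (fun ω ↦ A ω ^ 4) P := by
      have := hA4.integrable_norm_pow (by norm_num)
      simpa [Real.norm_eq_abs, Even.pow_abs (by decide : Even 4)] using this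
    have iN4 : ∀ k, Integrable (fun ω ↦ N k ω ^ 4) P := fun k ↦ by
      have := (hN4 k).1.integrable_norm_pow (by norm_num)
      simpa [Real.norm_eq_abs, Even.pow_abs (by decide : Even 4)] using this
    have hle : ∀ ω, (A ω + ∑ k, N k ω) ^ 4 ≤ 8 * A ω ^ 4 + 8 * ((d : ℝ) ^ 3 * ∑ k, N k ω ^ 4) := by
      intro ω
      have h1 : (A ω + ∑ k, N k ω) ^ 4 ≤ 8 * A ω ^ 4 + 8 * (∑ k, N k ω) ^ 4 := by
        nlinarith [sq_nonneg (A ω - ∑ k, N k ω), sq_nonneg (A ω + ∑ k, N k ω),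
          sq_nonneg (A ω ^ 2 - (∑ k, N k ω) ^ 2), sq_nonneg (A ω), sq_nonneg (∑ k, N k ω)]
      have h2 : (∑ k, N k ω) ^ 4 ≤ (d : ℝ) ^ 3 * ∑ k, N k ω ^ 4 := by
        have := pow_four_sum_le (univ : Finset (Fin d)) (fun k ↦ N k ω)
        simpa using this
      linarith
    have iR : Integrable (fun ω ↦ 8 * A ω ^ 4 + 8 * ((d : ℝ) ^ 3 * ∑ k, N k ω ^ 4)) P :=
      (iA4.const_mul 8).add (((integrable_finsetSum _ fun k _ ↦ iN4 k).const_mul _).const_mul 8)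
    refine (integral_mono_of_nonneg (ae_of_all _ fun ω ↦ by positivity) iR (ae_of_all _ hle)).trans ?_
    rw [integral_add (iA4.const_mul 8) (((integrable_finsetSum _ fun k _ ↦ iN4 k).const_mul _).const_mul 8),
      integral_const_mul, integral_const_mul, integral_const_mul, integral_finsetSum _ fun k _ ↦ iN4 k]
    have bA : ∫ ω, A ω ^ 4 ∂P ≤ (M * δ) ^ 4 := by
      have h := integral_mono iA4 (integrable_const ((M * δ) ^ 4)) fun ω ↦ (show A ω ^ 4 ≤ (M * δ) ^ 4 by
        rw [← Even.pow_abs (by decide : Even 4)]; exact pow_le_pow_left₀ (abs_nonneg _) (hAb ω) 4)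
      simpa using h
    have bN : ∑ k, ∫ ω, N k ω ^ 4 ∂P ≤ (d : ℝ) * (9 * M ^ 4 * δ ^ 2) := by
      have h := sum_le_sum fun k (_ : k ∈ (univ : Finset (Fin d))) ↦ (hN4 k).2
      simpa using h
    have hd : (0 : ℝ) ≤ d := Nat.cast_nonneg d
    have hd3 : (0 : ℝ) ≤ (d : ℝ) ^ 3 := by positivity
    nlinarith [bA, bN, hd, hd3, mul_le_mul_of_nonneg_left bN hd3]

end Vec

end Summit.QuantumFields.YangMills.Theorems.ColdStartUniversality

end
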